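import Summits.BirchSwinnertonDyer.BirchSwinnertonDyer.Theorems.ClassRecordThreeEulerHalvesAtThreeJetchev
import Summits.BirchSwinnertonDyer.Rank1Residual.X11b.Three.CornerDischarge
import Summits.BirchSwinnertonDyer.Rank1Residual.X11b.Three.CornerResidual
import Summits.BirchSwinnertonDyer.Rank1Residual.X11b.Three.KolyvaginNonvanishing
import Summits.BirchSwinnertonDyer.Rank1Residual.X11b.ChaRoute
import Summits.BirchSwinnertonDyer.BirchSwinnertonDyer.Theses.ClassRecordThree
import Literature.NumberTheory.EllipticCurves.Cha2005.ShaStructureIrreducible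

/-!
# Route `ClassRecordThree` (rung K2@3), crux 7 `CornerAtThree` (item 19111): the KOLYVAGIN ROAD on the
# NON-SURJECTIVE corner at `3` — Kolyvagin's structure theorem under IRREDUCIBILITY (Cha 2005 Thm. 21 +
# Rmk. 25; Matar–Nekovář 2019 Thm. 0.7 + §0.9 ∕ §0.11; Jetchev 2008 Rem. 6.2) REPLACES the corner's STEP L
# and its Tamagawa-sharp upper input by the refined Kolyvagin conjecture `M_∞ = t` on corner frames
# (cell `bsd-stepL`, seat `bsd-stepL-corner-p1` g2; `--supports stmt-BirchSwinnertonDyer-19111`)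

Item 19111 `CornerAtThree := ∀ W, Three.CornerStepLAt W ∧ Three.CornerTwistAt W ∧ Three.CornerUpperAt W`
is the (T4″)@3 corner of class X11b at `3` (`r_an = 1`, `3 ∥ N`, `E[3]` irreducible, `ρ̄_{E,3}` NOT onto —
image a `2`-group in the normaliser of a Cartan, hence of order PRIME TO `3`, so `3 ∣ ord₃ Δ_min` and NO
(ram) witness): (L) STEP L in anticyclotomic-IMC currency without `Surj` [no printed divisibility for a
Cartan-normaliser image at any `p`], (Tw) `BSD(E^{d_K},3)` for the rank-`0` Heegner twists, (U♯) the
Tamagawa-SHARP Kolyvagin bound over `K` on `3 ∣ ∏c` [no source]. x11b3's discharge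
(`Three.missingPPartAt_of_corner_of_inputs`, `CornerDischarge.lean`) feeds (L) through Gross–Zagier as
`IndexLowerBoundAt` and (U♯) through `missingUpperBoundAt_of_shaIndexBound_sharp`.

THE POINT OF THIS FILE. The Kolyvagin road of the cell (koly ∕ tam3-p1: `M_∞ = t` + McCallum's Cor. 5.6
⟹ both halves of `BSD₃(E/K)`) was CLOSED to the corner only because the tree's McCallum facts carry
`∀ n, ρ̄_{E,3^n}` onto. Kolyvagin's structure theorem `#Ш(E/K)[p^∞] = p^{2(M₀ − M_∞)}` is asserted in
print for IRREDUCIBLE `ρ̄_{E,p}` with `p ∤ 2d_K`, `p² ∤ N` (Cha 2005 Thm. 21 + Rmk. 25; Matar–Nekovář 2019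
§0.9 "He also showed [3, Thm. 21, Rmk. 25] that the statement of Theorem 0.7 holds under the same
assumptions", §0.11; Jetchev 2008 Rem. 6.2) — now the Literature facts
`Cha2005.rmk25_pow_dvd_card_sha_primary_of_certificate` ∕ `…_add_le_of_globalDivisibility` (p422597,
flag `Cha05-Rmk25-structure`). On the corner every hypothesis of those facts is AUTOMATIC (non-CM and
`3² ∤ N` from `3 ∥ N`; `3 ∤ d_K` from the Heegner hypothesis; `E[3]` irreducible is a field of the class;
`d_K ≠ −3, −4` from the odd Hoffstein–Luo field), so:

* §1 (ANY odd multiplicative `p`, `E[p]` irreducible; one frame):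
  `shaIndexBound_sharp_of_globalDivisibility_of_irreducible` — global `p^s`-divisibility of the derived
  Heegner points to depth `t` (`M_∞ ≥ t`) ⟹ `ord_p #Ш(E/K) + 2t ≤ 2·ord_p[E(K):ℤP]`;
  `indexLowerBoundAt_of_certificate_of_irreducible` ∕ `…_of_certificateAt_…` — ONE Kolyvagin certificate of
  level `M + 1`, `M ≤ t = ord_p ∏_ℓ c_ℓ(E)` (`M_∞ ≤ t`) ⟹ STEP L in Gross–Zagier currency
  `X11b.IndexLowerBoundAt W p K P`. (tam3-p1's §1 and koly's `indexLowerBoundAt_of_certificate_of_mccallum`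
  with tower surjectivity ↦ `Irr`; used by the `p ≥ 5` corner file as well.)
* §2 `cornerUpperAt_of_jetchevDivisibility_of_irreducible` ∕ `forall_…` — **conjunct (U♯)
  `Three.CornerUpperAt W` of crux `CornerAtThree`, for every `W`, modulo ONE hypothesis-shaped input J₃ᶜ**
  (the Jetchev direction `M_∞ ≥ t` on corner frames — the corner twin of tam3-p1's J₃ʳ ∕ J₃⁰, which carry
  `Surj`) and the PUBLISHED Kolyvagin, Shimura reciprocity, Darmon 3.6, Cha ∕ MN19 structure fact.
* File 2/2 (`ClassRecordThreeCornerAtThreeKolyvaginRecord.lean`): §3 the corner's typed missing `3`-part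
  `Typed.MissingPPartAt W 3` from {Z₃ᶜ (a certificate of level `≤ t + 1` on every odd Manin-good frame:
  `M_∞ ≤ t`), J₃ᶜ, (Tw) `CornerTwistAt W`} + published — NO `CornerStepLAt`, NO main conjecture, NO control
  identity; §4 the v4 corner binders `hCs` ∕ `hCn` and CLASS RECORD v4.1 with the corner inputs
  `{CornerStepLAt, CornerUpperAt}` replaced by `{Z₃ᶜ, J₃ᶜ}`.

HONEST FRAMING. Nothing here proves Z₃ᶜ, J₃ᶜ or (Tw): the first two are hypothesis SHAPES (no `def`, no
named fact; the two halves of `M_∞ = t`, Jetchev 2008 Conj. 1.3 ∕ BCGS 2023 Thm. 2 shape, NOT in print at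
`p ∣ N` nor for a non-surjective image), (Tw) is x11b3-p8's typed `@[conjecture]` input. Item 19111 does NOT
close; the K2@3 leaf is untouched; BSD is not advanced by bookkeeping; O2 OPEN; no census word moves. What
the file buys: on the corner the IMC-type residual (programme object K6 «anticyclotomic divisibility for a
Cartan-normaliser image», no print anywhere) is no longer needed — the corner needs exactly what the (ram)
∧ surj locus needs on the Kolyvagin road (`M_∞ = t`) plus the rank-`0` twin's `3`-part. The structure fact
is flagged `Cha05-Rmk25-structure` (remark-level print, three refereed attestations; referee's ruling).
CONDITIONAL on every binder listed in each theorem.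

References: [Cha2005] Thm. 21, Rmk. 25 (pp. 173–175); [MatarNekovar2019] Thm. 0.3, 0.7, §0.9, §0.11
(pp. 456–457); [Jetchev2008] (1), Conj. 1.3, Rem. 6.2; [McCallumLMS1991] §5 Lemma 5.1, Cor. 5.6;
[WZhang2014] Thm. 1.1, Rem. 5; [JetchevSkinnerWan2017] §7.4.1–7.4.2; [Darmon2004] Thm. 3.6; [GrossLMS1991]
§4 (4.1); [Miller2011LMS] Def. 1.1; tree: tam3-p1 `Theorems/ClassRecordThreeEulerHalvesAtThreeJetchev.lean`
(p419384), koly `X11b/Three/KolyvaginLineCertificate.lean`, `KolyvaginNonvanishing.lean`, x11b3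
`X11b/Three/{CornerResidual, CornerDischarge, ClassRecordResidual}.lean`.
-/
noncomputable section

open scoped Classical


namespace Summit.BirchSwinnertonDyer.Rank1Residual.X11b.Three.Koly

open scoped NumberField

open WeierstrassCurve Literature.NumberTheory.EllipticCurves
  Literature.NumberTheory.EllipticCurves.ModularForms
  Literature.NumberTheory.EllipticCurves.Rank1Residual
  Literature.NumberTheory.EllipticCurves.Rank1Residual.Typed
  Literature.NumberTheory.EllipticCurves.Wuthrich2014
  Literature.NumberTheory.GaloisRepresentations Literature.NumberTheory.GaloisCohomology
  Summit.BirchSwinnertonDyer.Rank1Residual Summit.BirchSwinnertonDyer.Rank1Residual.X11b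

/-! ### §1 One frame, any odd multiplicative `p` with `E[p]` irreducible: the two halves of
`#Ш(E/K)[p^∞] = p^{2(M₀ − M_∞)}` in the tree's currencies -/

/-- **UPPER: the Tamagawa-sharpened Kolyvagin bound over `K` from global divisibility (one frame), for
IRREDUCIBLE `ρ̄_{E,p}`.** `W/ℚ` globally minimal, multiplicative at the odd prime `p` (so non-CM and
`p² ∤ N_E`) with `E[p]` irreducible; `K` imaginary quadratic Heegner for `N_E` (so `p ∤ d_K`) with
`d_K ∉ {−3, −4}`; a conductor-`1` Kolyvagin–Heegner datum `d₁` on the frame `(Dt, β, ι)` whose derived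
point is `P ∈ E(K)` in `E(K̄)`, `P` of infinite order, `E(K)` of rank one without `p`-torsion, `Ш(E/K)`
finite: IF every derived point `P_n` on the frame (`n` a square-free product of Kolyvagin primes of index
`≥ s`) is `p^s`-divisible in `E(K_n)` for all `s ≤ t` (`hglob`: `M_∞ ≥ t`) THEN
`ord_p #Ш(E/K) + 2t ≤ 2·ord_p [E(K):ℤP]`. This is tam3-p1's `shaIndexBound_sharp_three_of_globalDivisibility`
with `Surj W 3` (tower surjectivity from the Tate line) REPLACED by `Irr W p`, through the cited fact
`Cha2005.rmk25_padicValNat_card_sha_primary_add_le_of_globalDivisibility` (`hChaU`). CONDITIONAL on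
`hChaU` (flag `Cha05-Rmk25-structure`) and `hglob`.
[cite: Cha2005, Thm. 21 and Rmk. 25 (pp. 173–175)] [cite: MatarNekovar2019, Thm. 0.7, §0.9, §0.11 (pp. 456–457)]
[cite: McCallumLMS1991, §5 Cor. 5.6 (p. 310) and Lemma 5.1 (p. 303)] -/
theorem shaIndexBound_sharp_of_globalDivisibility_of_irreducible
    (hChaU : Cha2005.rmk25_padicValNat_card_sha_primary_add_le_of_globalDivisibility)
    (W : WeierstrassCurve ℚ) [W.IsElliptic] [W.IsGloballyMinimal] [NeZero (W.conductorNorm ℤ)]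
    (K : Type) [Field K] [NumberField K] (p : ℕ) [Fact p.Prime] (hp2 : p ≠ 2)
    (hmult : W.HasMultiplicativeReductionAtPrime p) (hirr : Irr W p)
    (hK : IsImaginaryQuadratic K) (h3 : NumberField.discr K ≠ -3) (h4 : NumberField.discr K ≠ -4)
    (hHN : SatisfiesHeegnerHypothesis (W.conductorNorm ℤ) K)
    (Dt : ModularParametrizationData W (W.conductorNorm ℤ)) (β : ℤ) (ι : K →+* ℂ)
    (d₁ : KolyvaginHeegnerData Dt β ι 1) (P : (W.baseChange K).toAffine.Point)
    (hPd : d₁.toGeomPoints d₁.derivedPoint = toGeomPoints (W.baseChange K) P)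
    (hPinf : ¬ IsOfFinAddOrder P)
    (hrank : (W.baseChange K).mordellWeilRank = 1)
    (hiv : ∀ x : (W.baseChange K).toAffine.Point, p • x = 0 → x = 0)
    [Finite (W.baseChange K).sha] {t : ℕ}
    (hglob : ∀ (s : ℕ), s ≤ t → ∀ (n : ℕ) (d : KolyvaginHeegnerData Dt β ι n), Squarefree n →
      (∀ ℓ ∈ n.primeFactors, Zhang2014.IsKolyvaginPrime (W.conductorNorm ℤ) W K p ℓ ∧
        s ≤ Zhang2014.kolyvaginIndex W p ℓ) → PDiv d p s) :
    padicValNat p (Nat.card (W.baseChange K).sha) + 2 * t ≤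
      2 * padicValNat p (AddSubgroup.zmultiples P).index := by
  have hp : p.Prime := Fact.out
  -- Cha's standing hypotheses: no CM and `p² ∤ N` (multiplicative at `p`), `p ∤ d_K` (Heegner, `p ∣ N`)
  have hCM : ¬ W.HasCM := not_hasCM_of_hasMultiplicativeReductionAtPrime' W hmult
  have hpN2 : ¬ p ^ 2 ∣ W.conductorNorm ℤ := not_sq_dvd_conductorNorm_of_mult W p hmult
  have hpN : p ∣ W.conductorNorm ℤ :=
    (W.dvd_conductorNorm_iff_not_hasGoodReductionAtPrime p).mpr
      (WeierstrassCurve.HasMultiplicativeReduction.not_hasGoodReduction (R := ℤ_[p]) hmult)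
  have hpD : ¬ (p : ℤ) ∣ NumberField.discr K := not_dvd_discr_of_satisfiesHeegnerHypothesis hK hHN hp hpN
  -- the exponent p^{M₀} ∥ P (Mordell–Weil)
  haveI : Module.Finite ℤ (W.baseChange K).toAffine.Point := (W.baseChange K).module_finite_point_holds
  obtain ⟨M₀, x₀, hx₀, hmax⟩ := exists_pow_smul_eq_and_forall_ne hPinf (p := p) hp.two_le
  have hdiv : ∃ Q : (W.baseChange K).toAffine.Point, ((p ^ M₀ : ℕ) : ℤ) • Q = P :=
    ⟨x₀, by rw [natCast_zsmul]; exact hx₀⟩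
  have hndiv : ¬ ∃ Q : (W.baseChange K).toAffine.Point, ((p ^ (M₀ + 1) : ℕ) : ℤ) • Q = P := by
    rintro ⟨Q, hQ⟩
    exact hmax Q (by rw [← natCast_zsmul]; exact hQ)
  -- the structure theorem under irreducibility, upper form
  have hle : padicValNat p (Nat.card (AddCommGroup.primaryComponent (W.baseChange K).sha p)) + 2 * t ≤
      2 * M₀ :=
    hChaU W hCM K hK h3 h4 hHN p hp2 hpD hpN2 hirr Dt β ι d₁ P hPd hPinf M₀ hdiv hndiv t
      (fun s hs n d hn hℓ ↦ hglob s hs n d hn hℓ)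
  -- `ord_p #Ш = ord_p #Ш[p^∞]` and `ord_p [E(K):ℤP] = M₀`
  have hsha : padicValNat p (Nat.card (AddCommGroup.primaryComponent (W.baseChange K).sha p)) =
      padicValNat p (Nat.card (W.baseChange K).sha) :=
    padicValNat_card_addPrimaryComponent (A := (W.baseChange K).sha) p
  haveI : Finite (AddCommGroup.torsion (W.baseChange K).toAffine.Point) :=
    WeierstrassCurve.finite_torsion_point (W := W.baseChange K)
  obtain ⟨c, Q, hcQ, hcker⟩ := RankOne.exists_coord_of_mordellWeilRank_eq_one (W.baseChange K) hrank
  have hidx : padicValNat p (AddSubgroup.zmultiples P).index = M₀ :=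
    padicValNat_index_zmultiples_eq_of_divisibility c Q hcQ hcker hiv P hdiv hndiv
  rw [hidx, ← hsha]
  exact hle

/-- **LOWER: STEP L in Gross–Zagier currency from ONE Kolyvagin certificate (one frame), for IRREDUCIBLE
`ρ̄_{E,p}`.** Same frame data as `shaIndexBound_sharp_of_globalDivisibility_of_irreducible`; a
certificate `(n, M, d)` — `n` a square-free product of Kolyvagin primes of index `≥ M + 1`, `d` a
Kolyvagin–Heegner datum of conductor `n` with `P_n ∉ p^{M+1} E(K_n)` (`M_∞ ≤ M`) — with
`M ≤ t = ord_p ∏_ℓ c_ℓ(E)` gives `X11b.IndexLowerBoundAt W p K P` (`2·ord_p[E(K):ℤP] ≤ ord_p #Ш(E/K) + 2t`).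
This is x11b3/koly's `indexLowerBoundAt_of_certificate_of_mccallum` with the tower-surjectivity binder
REPLACED by `Irr W p`, through `Cha2005.rmk25_pow_dvd_card_sha_primary_of_certificate` (`hChaL`).
CONDITIONAL on `hChaL` (flag `Cha05-Rmk25-structure`) and the certificate.
[cite: Cha2005, Thm. 21 and Rmk. 25 (pp. 173–175)] [cite: MatarNekovar2019, Thm. 0.7, §0.9, §0.11 (pp. 456–457)]
[cite: McCallumLMS1991, §5 Cor. 5.6 (p. 310) and Lemma 5.1 (p. 303)] -/
theorem indexLowerBoundAt_of_certificate_of_irreducible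
    (hChaL : Cha2005.rmk25_pow_dvd_card_sha_primary_of_certificate)
    (W : WeierstrassCurve ℚ) [W.IsElliptic] [W.IsGloballyMinimal] [NeZero (W.conductorNorm ℤ)]
    (K : Type) [Field K] [NumberField K] (p : ℕ) [Fact p.Prime] (hp2 : p ≠ 2)
    (hmult : W.HasMultiplicativeReductionAtPrime p) (hirr : Irr W p)
    (hK : IsImaginaryQuadratic K) (h3 : NumberField.discr K ≠ -3) (h4 : NumberField.discr K ≠ -4)
    (hHN : SatisfiesHeegnerHypothesis (W.conductorNorm ℤ) K)
    (Dt : ModularParametrizationData W (W.conductorNorm ℤ)) (β : ℤ) (ι : K →+* ℂ)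
    (d₁ : KolyvaginHeegnerData Dt β ι 1) (P : (W.baseChange K).toAffine.Point)
    (hPd : d₁.toGeomPoints d₁.derivedPoint = toGeomPoints (W.baseChange K) P)
    (hPinf : ¬ IsOfFinAddOrder P)
    (hrank : (W.baseChange K).mordellWeilRank = 1)
    (hiv : ∀ x : (W.baseChange K).toAffine.Point, p • x = 0 → x = 0)
    [Finite (W.baseChange K).sha]
    {n M : ℕ} (d : KolyvaginHeegnerData Dt β ι n) (hn : Squarefree n)
    (hℓ : ∀ ℓ ∈ n.primeFactors, Zhang2014.IsKolyvaginPrime (W.conductorNorm ℤ) W K p ℓ ∧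
      M + 1 ≤ Zhang2014.kolyvaginIndex W p ℓ)
    (hcert : ¬ PDiv d p (M + 1)) (hMt : M ≤ padicValNat p W.tamagawaProduct) :
    IndexLowerBoundAt W p K P := by
  have hp : p.Prime := Fact.out
  have hCM : ¬ W.HasCM := not_hasCM_of_hasMultiplicativeReductionAtPrime' W hmult
  have hpN2 : ¬ p ^ 2 ∣ W.conductorNorm ℤ := not_sq_dvd_conductorNorm_of_mult W p hmult
  have hpN : p ∣ W.conductorNorm ℤ :=
    (W.dvd_conductorNorm_iff_not_hasGoodReductionAtPrime p).mpr
      (WeierstrassCurve.HasMultiplicativeReduction.not_hasGoodReduction (R := ℤ_[p]) hmult)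
  have hpD : ¬ (p : ℤ) ∣ NumberField.discr K := not_dvd_discr_of_satisfiesHeegnerHypothesis hK hHN hp hpN
  haveI : Module.Finite ℤ (W.baseChange K).toAffine.Point := (W.baseChange K).module_finite_point_holds
  obtain ⟨M₀, x₀, hx₀, hmax⟩ := exists_pow_smul_eq_and_forall_ne hPinf (p := p) hp.two_le
  have hdiv : ∃ Q : (W.baseChange K).toAffine.Point, ((p ^ M₀ : ℕ) : ℤ) • Q = P :=
    ⟨x₀, by rw [natCast_zsmul]; exact hx₀⟩
  have hndiv : ¬ ∃ Q : (W.baseChange K).toAffine.Point, ((p ^ (M₀ + 1) : ℕ) : ℤ) • Q = P := by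
    rintro ⟨Q, hQ⟩
    exact hmax Q (by rw [← natCast_zsmul]; exact hQ)
  -- the structure theorem under irreducibility, lower form: `p^{2(M₀ − M)} ∣ #Ш(E/K)[p^∞]`
  have hdvd := hChaL W hCM K hK h3 h4 hHN p hp2 hpD hpN2 hirr Dt β ι d₁ P hPd hPinf M₀ hdiv hndiv n M d
    hn hℓ hcert
  have hpos : Nat.card (AddCommGroup.primaryComponent (W.baseChange K).sha p) ≠ 0 := Nat.card_pos.ne'
  have hle : 2 * (M₀ - M) ≤
      padicValNat p (Nat.card (AddCommGroup.primaryComponent (W.baseChange K).sha p)) :=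
    (padicValNat_dvd_iff_le hpos).mp hdvd
  have hsha : padicValNat p (W.baseChange K).shaOrder =
      padicValNat p (Nat.card (AddCommGroup.primaryComponent (W.baseChange K).sha p)) :=
    padicValNat_shaOrder_eq (W.baseChange K) p
  haveI : Finite (AddCommGroup.torsion (W.baseChange K).toAffine.Point) :=
    WeierstrassCurve.finite_torsion_point (W := W.baseChange K)
  obtain ⟨c, Q, hcQ, hcker⟩ := RankOne.exists_coord_of_mordellWeilRank_eq_one (W.baseChange K) hrank
  have hidx : padicValNat p (AddSubgroup.zmultiples P).index = M₀ :=
    padicValNat_index_zmultiples_eq_of_divisibility c Q hcQ hcker hiv P hdiv hndiv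
  unfold IndexLowerBoundAt
  rw [hidx, hsha]
  omega

/-- **LOWER, packaged certificate**: `Koly.CertificateAt Dt β ι p M` with `M ≤ ord_p ∏_ℓ c_ℓ(E)` gives
`IndexLowerBoundAt W p K P`, for IRREDUCIBLE `ρ̄_{E,p}` (koly's
`indexLowerBoundAt_of_certificateAt_of_mccallum` with tower surjectivity ↦ `Irr`). CONDITIONAL on `hChaL`.
[cite: Cha2005, Rmk. 25 (p. 175)] [cite: McCallumLMS1991, §5 Cor. 5.6 (p. 310)] -/
theorem indexLowerBoundAt_of_certificateAt_of_irreducible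
    (hChaL : Cha2005.rmk25_pow_dvd_card_sha_primary_of_certificate)
    (W : WeierstrassCurve ℚ) [W.IsElliptic] [W.IsGloballyMinimal] [NeZero (W.conductorNorm ℤ)]
    (K : Type) [Field K] [NumberField K] (p : ℕ) [Fact p.Prime] (hp2 : p ≠ 2)
    (hmult : W.HasMultiplicativeReductionAtPrime p) (hirr : Irr W p)
    (hK : IsImaginaryQuadratic K) (h3 : NumberField.discr K ≠ -3) (h4 : NumberField.discr K ≠ -4)
    (hHN : SatisfiesHeegnerHypothesis (W.conductorNorm ℤ) K)
    (Dt : ModularParametrizationData W (W.conductorNorm ℤ)) (β : ℤ) (ι : K →+* ℂ)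
    (d₁ : KolyvaginHeegnerData Dt β ι 1) (P : (W.baseChange K).toAffine.Point)
    (hPd : d₁.toGeomPoints d₁.derivedPoint = toGeomPoints (W.baseChange K) P)
    (hPinf : ¬ IsOfFinAddOrder P)
    (hrank : (W.baseChange K).mordellWeilRank = 1)
    (hiv : ∀ x : (W.baseChange K).toAffine.Point, p • x = 0 → x = 0)
    [Finite (W.baseChange K).sha]
    {M : ℕ} (hcert : CertificateAt Dt β ι p M) (hMt : M ≤ padicValNat p W.tamagawaProduct) :
    IndexLowerBoundAt W p K P := by
  obtain ⟨n, r, d, hn, hc⟩ := hcert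
  exact indexLowerBoundAt_of_certificate_of_irreducible hChaL W K p hp2 hmult hirr hK h3 h4 hHN Dt β ι
    d₁ P hPd hPinf hrank hiv d hn.1 hn.2.2 hc hMt

/-! ### §2 The corner at `3`: conjunct (U♯) `CornerUpperAt` DISCHARGED modulo the Jetchev direction J₃ᶜ -/

/-- **`Three.CornerUpperAt W` (the Tamagawa-SHARP Kolyvagin bound over `K` on the non-surjective corner
at `3`, conjunct 3 of crux `CornerAtThree`) from the JETCHEV DIRECTION on corner frames + Kolyvagin's
structure theorem under irreducibility.** PUBLISHED binders: Kolyvagin (`hKo`: rank one ∕ finiteness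
over `K`), Shimura reciprocity at conductor `1` (`hrec`), Darmon 2004 Thm. 3.6 (`hD36`: a conductor-`1`
Kolyvagin–Heegner datum exists on every frame), and the cited structure fact `hChaU`
(`Cha2005.rmk25_padicValNat_card_sha_primary_add_le_of_globalDivisibility`, flag `Cha05-Rmk25-structure`).
ONE OPEN input, hypothesis-shaped (nothing asserted): **J₃ᶜ** (`hJ`) — on every Manin-good
conductor-`N_E` frame `(Dt, β, ι)` of a corner pair (`(E,3) ∈` X11b, `ρ̄_{E,3}` NOT onto) over an odd
imaginary quadratic Heegner field, every derived Heegner point `P_n` (`n` a square-free product of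
Kolyvagin primes of index `≥ s`, `n = 1` allowed) is `3^s`-divisible in `E(K_n)` for all
`s ≤ t = ord₃ ∏_ℓ c_ℓ(E)` — McCallum's `M_∞ ≥ t`, the `≥`-half of the refined Kolyvagin conjecture
`M_∞ = t` (Jetchev 2008 Conj. 1.3; BCGS 2023 Thm. 2 at good ordinary `p`); the corner TWIN of tam3-p1's
J₃ʳ ∕ J₃⁰ (which carry `Surj`). Proof: at a datum of `CornerUpperAt` (level `N = N_E`), Darmon's
conductor-`1` datum on the frame `(Dt, H.β, ι)`, bottom point `P_1 = y_K = P` (Shimura reciprocity),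
rank one (Kolyvagin), no `3`-torsion (irreducibility), then §1. On the `3 ∤ ∏c` sub-corner J₃ᶜ is
vacuous (`t = 0`) and the bound is Matar–Nekovář's. CONDITIONAL on `hJ` and `hChaU`; nothing booked.
[cite: Cha2005, Thm. 21 and Rmk. 25 (pp. 173–175)] [cite: MatarNekovar2019, Thm. 0.7, §0.9, §0.11 (pp. 456–457)]
[cite: McCallumLMS1991, §5 Cor. 5.6 (p. 310)] [cite: Jetchev2008, Conj. 1.3 and (1) (p. 812)]
[cite: Darmon2004, Thm. 3.6 (PDF p. 43)] [cite: GrossLMS1991, §4 (4.1)] -/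
theorem cornerUpperAt_of_jetchevDivisibility_of_irreducible
    (hKo : ∀ (N : ℕ) [NeZero N] (W : WeierstrassCurve ℚ) (K : Type) [Field K] [NumberField K],
      kolyvagin N W K)
    (hrec : ∀ (N : ℕ) [NeZero N] (W : WeierstrassCurve ℚ) (K : Type) [Field K] [NumberField K],
      heegnerPointOfConductor_one_galoisConj N W K)
    (hD36 : ∀ (N : ℕ) [NeZero N] (W : WeierstrassCurve ℚ) (K : Type) [Field K] [NumberField K],
      phi_heegnerTau_mem_singularModuliField N W K)
    (hChaU : Cha2005.rmk25_padicValNat_card_sha_primary_add_le_of_globalDivisibility)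
    -- OPEN INPUT J₃ᶜ: the Jetchev direction `M_∞ ≥ t` on CORNER frames (hypothesis shape; no Surj, no Ram)
    (hJ : ∀ (W : WeierstrassCurve ℚ) [W.IsElliptic] [W.IsGloballyMinimal] [NeZero (W.conductorNorm ℤ)]
      (K : Type) [Field K] [NumberField K]
      (Dt : ModularParametrizationData W (W.conductorNorm ℤ)) (β : ℤ) (ι : K →+* ℂ),
      ClassX11b W 3 → ¬ Surj W 3 →
      IsImaginaryQuadratic K → SatisfiesHeegnerHypothesis (W.conductorNorm ℤ) K →
      Odd (NumberField.discr K) →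
      (4 * (W.conductorNorm ℤ : ℤ)) ∣ β ^ 2 - NumberField.discr K → ¬ (3 : ℤ) ∣ Dt.c →
      ∀ (s : ℕ), s ≤ padicValNat 3 W.tamagawaProduct →
        ∀ (n : ℕ) (d : KolyvaginHeegnerData Dt β ι n), Squarefree n →
          (∀ ℓ ∈ n.primeFactors, Zhang2014.IsKolyvaginPrime (W.conductorNorm ℤ) W K 3 ℓ ∧
            s ≤ Zhang2014.kolyvaginIndex W 3 ℓ) → PDiv d 3 s)
    (W : WeierstrassCurve ℚ) [W.IsElliptic] [W.IsGloballyMinimal] : CornerUpperAt W := by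
  haveI : Fact (Nat.Prime 3) := ⟨Nat.prime_three⟩
  intro N _ K _ _ Dt H ι P hX hns _ht hN hK hodd hHN _hLt hP hc hPinf hfin
  subst hN
  obtain ⟨_, _, hmult, hirr⟩ := id hX
  haveI : Finite (W.baseChange K).sha := hfin
  -- `d_K ≠ −3` (`3 ∣ N_E` splits in `K`) and `d_K ≠ −4` (`d_K` odd)
  have h3N : 3 ∣ W.conductorNorm ℤ := dvd_conductorNorm_of_classX11b hX
  have hpd : ¬ ((3 : ℕ) : ℤ) ∣ NumberField.discr K :=
    not_dvd_discr_of_satisfiesHeegnerHypothesis hK hHN Nat.prime_three h3N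
  have h3 : NumberField.discr K ≠ -3 := by
    intro h; apply hpd; rw [h]; exact ⟨-1, by norm_num⟩
  have h4 : NumberField.discr K ≠ -4 := by
    intro h; have := Int.odd_iff.mp hodd; omega
  -- a conductor-1 Kolyvagin–Heegner datum on the frame (Dt, H.β, ι) (Darmon 2004, Thm. 3.6)
  obtain ⟨d₁⟩ := exists_kolyvaginHeegnerData_one (hD36 _ W K) hK Dt H.β ι H.dvd_sq_sub
  -- the bottom point: P(1) = y_K = P in E(K̄) (Shimura reciprocity at conductor 1)
  have hPd : d₁.toGeomPoints d₁.derivedPoint = toGeomPoints (W.baseChange K) P :=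
    KolyvaginBottom.toGeomPoints_derivedPoint_one_eq (hrec _ W K) hK hHN hP d₁ rfl
  -- rank one (Kolyvagin) and no 3-torsion (E[3] irreducible, K imaginary quadratic)
  obtain ⟨hrank, -⟩ := hKo (W.conductorNorm ℤ) W K hK hHN ⟨Dt, H, ι, hP⟩ hPinf
  have hbot := torsionBy_eq_bot_of_isImaginaryQuadratic_of_hasIrreducibleModPGaloisRep W K hK
    Nat.prime_three hirr
  have hiv : ∀ x : (W.baseChange K).toAffine.Point, 3 • x = 0 → x = 0 := fun x hx ↦ by
    have hmem : x ∈ AddSubgroup.torsionBy (W.baseChange K).toAffine.Point ((3 : ℕ) : ℤ) := by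
      rw [mem_torsionBy_iff, natCast_zsmul]
      exact hx
    rw [hbot] at hmem
    exact hmem
  exact shaIndexBound_sharp_of_globalDivisibility_of_irreducible hChaU W K 3 (by norm_num) hmult hirr hK
    h3 h4 hHN Dt H.β ι d₁ P hPd hPinf hrank hiv (hJ W K Dt H.β ι hX hns hK hHN hodd H.dvd_sq_sub hc)

/-- **Conjunct 3 of crux `CornerAtThree` (item 19111) for EVERY `W`, modulo J₃ᶜ + published + the cited
structure fact** — `cornerUpperAt_of_jetchevDivisibility_of_irreducible` read class-wide, in the route's
vocabulary (`∀ W, Three.CornerUpperAt W` is the third component of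
`Theses.ClassRecordThree.CornerAtThree`). CONDITIONAL; nothing booked. [cite: Cha2005, Rmk. 25 (p. 175)]
[cite: McCallumLMS1991, §5 Cor. 5.6 (p. 310)] -/
theorem forall_cornerUpperAt_of_jetchevDivisibility_of_irreducible
    (hKo : ∀ (N : ℕ) [NeZero N] (W : WeierstrassCurve ℚ) (K : Type) [Field K] [NumberField K],
      kolyvagin N W K)
    (hrec : ∀ (N : ℕ) [NeZero N] (W : WeierstrassCurve ℚ) (K : Type) [Field K] [NumberField K],
      heegnerPointOfConductor_one_galoisConj N W K)
    (hD36 : ∀ (N : ℕ) [NeZero N] (W : WeierstrassCurve ℚ) (K : Type) [Field K] [NumberField K],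
      phi_heegnerTau_mem_singularModuliField N W K)
    (hChaU : Cha2005.rmk25_padicValNat_card_sha_primary_add_le_of_globalDivisibility)
    (hJ : ∀ (W : WeierstrassCurve ℚ) [W.IsElliptic] [W.IsGloballyMinimal] [NeZero (W.conductorNorm ℤ)]
      (K : Type) [Field K] [NumberField K]
      (Dt : ModularParametrizationData W (W.conductorNorm ℤ)) (β : ℤ) (ι : K →+* ℂ),
      ClassX11b W 3 → ¬ Surj W 3 →
      IsImaginaryQuadratic K → SatisfiesHeegnerHypothesis (W.conductorNorm ℤ) K →
      Odd (NumberField.discr K) →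
      (4 * (W.conductorNorm ℤ : ℤ)) ∣ β ^ 2 - NumberField.discr K → ¬ (3 : ℤ) ∣ Dt.c →
      ∀ (s : ℕ), s ≤ padicValNat 3 W.tamagawaProduct →
        ∀ (n : ℕ) (d : KolyvaginHeegnerData Dt β ι n), Squarefree n →
          (∀ ℓ ∈ n.primeFactors, Zhang2014.IsKolyvaginPrime (W.conductorNorm ℤ) W K 3 ℓ ∧
            s ≤ Zhang2014.kolyvaginIndex W 3 ℓ) → PDiv d 3 s) :
    ∀ (W : WeierstrassCurve ℚ) [W.IsElliptic] [W.IsGloballyMinimal],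
      Summit.BirchSwinnertonDyer.Rank1Residual.X11b.Three.CornerUpperAt W :=
  fun W _ _ ↦ cornerUpperAt_of_jetchevDivisibility_of_irreducible hKo hrec hD36 hChaU hJ W

end Summit.BirchSwinnertonDyer.Rank1Residual.X11b.Three.Koly

end
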